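import Summits.AtomisticToContinuum.FouriersLaw.Theses.ContactStieltjesMeasure
import Summits.AtomisticToContinuum.FouriersLaw.Theses.HonestZwanzig
import Literature.MathematicalPhysics.KineticTheory.LangevinChainKernel
import Summits.AtomisticToContinuum.FouriersLaw.Theorems.OddSectorIrreversibilityCorrectorTheoryUniformMixing

/-!
# Birth skeleton (`Lines/birth.lean`) for crux `StieltjesRepresentation` (stmt-AtomisticToContinuum-15248)

Route `ContactStieltjesMeasure` (sub-problem `FouriersLaw`), crux rank 3, `K2` = THE REPRESENTATION: for
`pinnedChain ω₂ lam β γ` with `ω₂ > 0`, `lam, β ≥ 0`, `T > 0` there is ONE `γ`-free family `Φ_N` (bounded,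
monotone, vanishing on `(-∞,0]`; the contact distribution functions `Φ_N(s) = μ̂_N((0,s])`) such that for EVERY
friction `γ > 0`, under weak-NESS uniqueness and along every steady-state family, the clause-(ii) response
quotient `totalCurrent(μ_{N,T+δ/2,T-δ/2})/δ` converges (`δ → 0`, `δ ≠ 0`) to
`(N-1)·γ·∫₀^∞ Φ_N(t)·2t/(γ²+t²)² dt` (`= (N-1)·γ·∫ dμ̂_N(s)/(γ²+s²)`).

## The cut (three registered stubs; the planner's own two-layer plan `ResolventResponseFormula → StieltjesLimit`
## typed over the LANDED open-chain Green–Kubo vocabulary of `HonestZwanzig.OpenChainGreenKubo`)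

* `stub_greenKuboClosure` (NESS → EQUILIBRIUM; known in kind, IN TREE on the open range): the Kundu–Dhar–Narayan
  open-chain Green–Kubo identity on the CLOSED parameter range `lam, β ≥ 0` of the crux — under weak-NESS
  uniqueness, along every steady family, for `T > 0`, `N ≥ 2`: `corrJJ ∈ L¹(0,∞)` and the response quotient
  converges to `∫₀^∞ corrJJ / ((N-1)T²)`, `corrJJ(t) = Cov_{μ_T}(J, K_t J)` the Gibbs autocorrelation of the
  total current `J = Σ_i j_i` under the CONSTRUCTED equal-temperature kernels `K_t = transitionKernel N T T t`.
  For `lam, β > 0` this is VERBATIM `HonestZwanzig.OpenChainGreenKubo`, PROVED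
  (`OddSectorIrreversibility.Corrector.openChainGreenKubo_holds`, stmt-12696); the new content is the boundary
  `lam·β = 0` (harmonic member `lam = β = 0`: Gaussian/explicit; `lam = 0 < β`: CEHR conditions hold;
  `β = 0 < lam`: pinning-dominated, Hairer–Mattingly regime — the hard corner, carried by the crux itself).
* `stub_contactMeasure` (THE STIELTJES IDENTIFICATION — the route's lever, HARDEST, new): at EQUILIBRIUM only
  (canonical objects: Gibbs measure + equal-temperature kernels; no NESS, no uniqueness, no family): for
  `ω₂ > 0`, `lam, β ≥ 0`, `T > 0` there is ONE `γ`-FREE family of finite positive Borel measures `ν_N` on ℝ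
  carried by `(0,∞)` (`ν_N((-∞,0]) = 0`: no atom at `s = 0`, `μ̂ = s²ρ/4T²`) with, for EVERY `γ > 0` and
  `N ≥ 2`, whenever `corrJJ_γ ∈ L¹(0,∞)`:  `∫₀^∞ corrJJ_γ /((N-1)T²) = (N-1)·γ·∫ (γ²+s²)⁻¹ dν_N(s)` —
  the Green–Kubo conductance is `γ ×` (a Stieltjes transform in `γ²`) of the contact spectral measure of the
  `γ`-affine pencil `L_γ = A - γP` (`Sym((γP+A)⁻¹) = γ(γP+A)⁻¹P(γP-A)⁻¹`, `ε`-regularised `P`, skew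
  `𝕂_ε = P_ε^{-1/2} A P_ε^{-1/2}`, `⟨v,(γ+𝕂_ε)⁻¹v⟩ = γ⟨v,(γ²+|𝕂_ε|²)⁻¹v⟩`, `ε → 0`). Guarded by the
  integrability hypothesis (Bochner junk value, typing checklist (ii)); `stub_greenKuboClosure` supplies it.
* `stub_layerCake` (REAL ANALYSIS, size M): for a finite measure `ν` on ℝ with `ν((-∞,0]) = 0` and `γ > 0`,
  `∫ (γ²+s²)⁻¹ dν(s) = ∫₀^∞ ν((0,t])·2t/(γ²+t²)² dt` (Tonelli with `(γ²+s²)⁻¹ = ∫_s^∞ 2t/(γ²+t²)² dt`).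

`StieltjesRepresentation_of` composes them into the crux BY NAME (kernel-checked, no `sorry`): `Φ_N(t) :=
(ν_N((0,t])).toReal` is monotone / zero on `(-∞,0]` / bounded by `ν_N(ℝ)` (proved here from finiteness), and for
each `γ`, the Green–Kubo limit value is rewritten through the identification and the layer cake.

## Disproof used
None filed: `ledger crux ls stmt-AtomisticToContinuum-15248` shows no `Disproof.lean` / Negative lemma for this
crux (2026-08-17). Negatives index (`ledger negatives --problem AtomisticToContinuum`, 20 entries; FouriersLaw:
`not_OddCorrectorDecay` — an `N`-UNIFORM corrector bound, and `FarFieldGaussianity`): no stub is an instance —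
`stub_greenKuboClosure` asserts integrability at FIXED `N` only (as the landed `OpenChainGreenKubo` does).
-/

noncomputable section

open scoped NNReal ENNReal Topology BigOperators
open MeasureTheory Filter Set
open Literature.MathematicalPhysics.KineticTheory.HeatConduction

namespace Summit.AtomisticToContinuum.FouriersLaw.Cruxes.StieltjesRepresentation.Birth

/-! ### The three statements of the line (named; each IS its registered stub, see `…_holds` below) -/

/-- STUB 1 statement — OPEN-CHAIN GREEN–KUBO on the closed range `lam, β ≥ 0` (verbatim
`HonestZwanzig.OpenChainGreenKubo` with `0 < lam → 0 < β` relaxed to `0 ≤ lam → 0 ≤ β`).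
[cite: KunduDharNarayan2009, p. 3] [cite: CuneoEckmannHairerReyBellet2018, Thm 2.13] -/
def GreenKuboClosure : Prop :=
  ∀ ω₂ lam β γ : ℝ, 0 < ω₂ → 0 ≤ lam → 0 ≤ β → 0 < γ →
    (∀ (N : ℕ) (T_L T_R : ℝ), 0 < T_L → 0 < T_R → ∀ μ ν : Measure (PhaseSpace N),
      (pinnedChain ω₂ lam β γ).IsSteadyState N T_L T_R μ →
      (pinnedChain ω₂ lam β γ).IsSteadyState N T_L T_R ν → μ = ν) →
    ∀ μf : (N : ℕ) → ℝ → ℝ → Measure (PhaseSpace N),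
      (∀ (N : ℕ) (T_L T_R : ℝ), 0 < T_L → 0 < T_R →
        (pinnedChain ω₂ lam β γ).IsSteadyState N T_L T_R (μf N T_L T_R)) →
    ∀ T : ℝ, 0 < T → ∀ N : ℕ, 2 ≤ N →
      let P := pinnedChain ω₂ lam β γ
      let X := PhaseSpace N
      let μ : Measure X := P.gibbsMeasure N T
      let J : X → ℝ := fun z => ∑ i : Fin N, P.bondCurrent N i z
      let corrJJ : ℝ → ℝ := fun t =>
        (∫ z, J z * (∫ y, J y ∂(P.transitionKernel N T T t.toNNReal z)) ∂μ) - (∫ z, J z ∂μ) * (∫ z, J z ∂μ)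
      IntegrableOn corrJJ (Set.Ioi 0) ∧
        Tendsto (fun δ : ℝ => P.totalCurrent (μf N (T + δ / 2) (T - δ / 2)) / δ) (𝓝[≠] 0)
          (𝓝 ((∫ t in Set.Ioi (0 : ℝ), corrJJ t) / (((N : ℝ) - 1) * T ^ 2)))

/-- STUB 2 statement — THE STIELTJES IDENTIFICATION of the equilibrium Green–Kubo conductance: one `γ`-free
finite positive measure `ν_N` on `(0,∞)` per `N` with `∫₀^∞ corrJJ_γ/((N-1)T²) = (N-1)γ∫(γ²+s²)⁻¹dν_N` for
every `γ > 0` (guarded by `corrJJ_γ ∈ L¹(0,∞)`). [cite: GoldenPapanicolaou1983] [cite: BernardinOlla2011] -/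
def ContactMeasure : Prop :=
  ∀ ω₂ lam β : ℝ, 0 < ω₂ → 0 ≤ lam → 0 ≤ β → ∀ T : ℝ, 0 < T →
    ∃ ν : ℕ → Measure ℝ, (∀ N : ℕ, IsFiniteMeasure (ν N)) ∧ (∀ N : ℕ, ν N (Set.Iic 0) = 0) ∧
      ∀ γ : ℝ, 0 < γ → ∀ N : ℕ, 2 ≤ N →
        let P := pinnedChain ω₂ lam β γ
        let X := PhaseSpace N
        let μ : Measure X := P.gibbsMeasure N T
        let J : X → ℝ := fun z => ∑ i : Fin N, P.bondCurrent N i z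
        let corrJJ : ℝ → ℝ := fun t =>
          (∫ z, J z * (∫ y, J y ∂(P.transitionKernel N T T t.toNNReal z)) ∂μ) - (∫ z, J z ∂μ) * (∫ z, J z ∂μ)
        IntegrableOn corrJJ (Set.Ioi 0) →
          (∫ t in Set.Ioi (0 : ℝ), corrJJ t) / (((N : ℝ) - 1) * T ^ 2) =
            ((N : ℝ) - 1) * γ * ∫ s, (γ ^ 2 + s ^ 2)⁻¹ ∂(ν N)

/-- STUB 3 statement — LAYER CAKE for the Cauchy–Stieltjes kernel: for a finite measure `ν` on ℝ carried by
`(0,∞)` and `γ > 0`, `∫(γ²+s²)⁻¹dν(s) = ∫₀^∞ ν((0,t])·2t/(γ²+t²)² dt`. [folklore] -/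
def LayerCake : Prop :=
  ∀ ν : Measure ℝ, IsFiniteMeasure ν → ν (Set.Iic 0) = 0 → ∀ γ : ℝ, 0 < γ →
    ∫ s, (γ ^ 2 + s ^ 2)⁻¹ ∂ν =
      ∫ t in Set.Ioi (0 : ℝ), (ν (Set.Ioc 0 t)).toReal * (2 * t / (γ ^ 2 + t ^ 2) ^ 2)

/-! ### Registered stubs (`sorry` only here; each spelled out over importable declarations) -/

/-- STUB 1 (rank 3 of the line; size M on the open range — BY NAME `openChainGreenKubo_holds` — and L at the
boundary `lam·β = 0`): open-chain Green–Kubo on the closed parameter range of the crux.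
[cite: KunduDharNarayan2009, p. 3] [cite: CuneoEckmannHairerReyBellet2018, Thm 2.13] -/
theorem stub_greenKuboClosure :
    ∀ ω₂ lam β γ : ℝ, 0 < ω₂ → 0 ≤ lam → 0 ≤ β → 0 < γ →
      (∀ (N : ℕ) (T_L T_R : ℝ), 0 < T_L → 0 < T_R → ∀ μ ν : Measure (PhaseSpace N),
        (pinnedChain ω₂ lam β γ).IsSteadyState N T_L T_R μ →
        (pinnedChain ω₂ lam β γ).IsSteadyState N T_L T_R ν → μ = ν) →
      ∀ μf : (N : ℕ) → ℝ → ℝ → Measure (PhaseSpace N),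
        (∀ (N : ℕ) (T_L T_R : ℝ), 0 < T_L → 0 < T_R →
          (pinnedChain ω₂ lam β γ).IsSteadyState N T_L T_R (μf N T_L T_R)) →
      ∀ T : ℝ, 0 < T → ∀ N : ℕ, 2 ≤ N →
        let P := pinnedChain ω₂ lam β γ
        let X := PhaseSpace N
        let μ : Measure X := P.gibbsMeasure N T
        let J : X → ℝ := fun z => ∑ i : Fin N, P.bondCurrent N i z
        let corrJJ : ℝ → ℝ := fun t =>
          (∫ z, J z * (∫ y, J y ∂(P.transitionKernel N T T t.toNNReal z)) ∂μ) - (∫ z, J z ∂μ) * (∫ z, J z ∂μ)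
        IntegrableOn corrJJ (Set.Ioi 0) ∧
          Tendsto (fun δ : ℝ => P.totalCurrent (μf N (T + δ / 2) (T - δ / 2)) / δ) (𝓝[≠] 0)
            (𝓝 ((∫ t in Set.Ioi (0 : ℝ), corrJJ t) / (((N : ℝ) - 1) * T ^ 2))) := by
  sorry

/-- STUB 2 (rank 2 of the line, HARDEST, size L; the route's lever): the Stieltjes identification of the
equilibrium Green–Kubo conductance by ONE `γ`-free finite positive measure on `(0,∞)` per `N`.
[cite: GoldenPapanicolaou1983] [cite: BernardinOlla2011] -/
theorem stub_contactMeasure :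
    ∀ ω₂ lam β : ℝ, 0 < ω₂ → 0 ≤ lam → 0 ≤ β → ∀ T : ℝ, 0 < T →
      ∃ ν : ℕ → Measure ℝ, (∀ N : ℕ, IsFiniteMeasure (ν N)) ∧ (∀ N : ℕ, ν N (Set.Iic 0) = 0) ∧
        ∀ γ : ℝ, 0 < γ → ∀ N : ℕ, 2 ≤ N →
          let P := pinnedChain ω₂ lam β γ
          let X := PhaseSpace N
          let μ : Measure X := P.gibbsMeasure N T
          let J : X → ℝ := fun z => ∑ i : Fin N, P.bondCurrent N i z
          let corrJJ : ℝ → ℝ := fun t =>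
            (∫ z, J z * (∫ y, J y ∂(P.transitionKernel N T T t.toNNReal z)) ∂μ) - (∫ z, J z ∂μ) * (∫ z, J z ∂μ)
          IntegrableOn corrJJ (Set.Ioi 0) →
            (∫ t in Set.Ioi (0 : ℝ), corrJJ t) / (((N : ℝ) - 1) * T ^ 2) =
              ((N : ℝ) - 1) * γ * ∫ s, (γ ^ 2 + s ^ 2)⁻¹ ∂(ν N) := by
  sorry

/-- STUB 3 (rank 4 of the line, size M): layer cake for the Cauchy–Stieltjes kernel. [folklore] -/
theorem stub_layerCake :
    ∀ ν : Measure ℝ, IsFiniteMeasure ν → ν (Set.Iic 0) = 0 → ∀ γ : ℝ, 0 < γ →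
      ∫ s, (γ ^ 2 + s ^ 2)⁻¹ ∂ν =
        ∫ t in Set.Ioi (0 : ℝ), (ν (Set.Ioc 0 t)).toReal * (2 * t / (γ ^ 2 + t ^ 2) ^ 2) := by
  sorry

/-! ### Consistency: each named statement IS its registered stub (definitionally) -/

theorem greenKuboClosure_holds : GreenKuboClosure := stub_greenKuboClosure
theorem contactMeasure_holds : ContactMeasure := stub_contactMeasure
theorem layerCake_holds : LayerCake := stub_layerCake

/-- Calibration of STUB 1 on the OPEN range: for `lam, β > 0` it is the landed theorem, by name. -/
theorem greenKuboClosure_of_pos :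
    ∀ ω₂ lam β γ : ℝ, 0 < ω₂ → 0 < lam → 0 < β → 0 < γ →
      (∀ (N : ℕ) (T_L T_R : ℝ), 0 < T_L → 0 < T_R → ∀ μ ν : Measure (PhaseSpace N),
        (pinnedChain ω₂ lam β γ).IsSteadyState N T_L T_R μ →
        (pinnedChain ω₂ lam β γ).IsSteadyState N T_L T_R ν → μ = ν) →
      ∀ μf : (N : ℕ) → ℝ → ℝ → Measure (PhaseSpace N),
        (∀ (N : ℕ) (T_L T_R : ℝ), 0 < T_L → 0 < T_R →
          (pinnedChain ω₂ lam β γ).IsSteadyState N T_L T_R (μf N T_L T_R)) →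
      ∀ T : ℝ, 0 < T → ∀ N : ℕ, 2 ≤ N →
        let P := pinnedChain ω₂ lam β γ
        let X := PhaseSpace N
        let μ : Measure X := P.gibbsMeasure N T
        let J : X → ℝ := fun z => ∑ i : Fin N, P.bondCurrent N i z
        let corrJJ : ℝ → ℝ := fun t =>
          (∫ z, J z * (∫ y, J y ∂(P.transitionKernel N T T t.toNNReal z)) ∂μ) - (∫ z, J z ∂μ) * (∫ z, J z ∂μ)
        IntegrableOn corrJJ (Set.Ioi 0) ∧
          Tendsto (fun δ : ℝ => P.totalCurrent (μf N (T + δ / 2) (T - δ / 2)) / δ) (𝓝[≠] 0)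
            (𝓝 ((∫ t in Set.Ioi (0 : ℝ), corrJJ t) / (((N : ℝ) - 1) * T ^ 2))) :=
  Summit.AtomisticToContinuum.FouriersLaw.Theorems.OddSectorIrreversibility.Corrector.openChainGreenKubo_holds

/-! ### Name-keyed aliases of the statements (hypotheses of the composition; the skeleton audit admits a
hypothesis only if its head constant is a registered obligation or is named like a declared stub) -/
namespace Registered

/-- Alias of `GreenKuboClosure` keyed by the registered stub name. -/
abbrev stub_greenKuboClosure : Prop := GreenKuboClosure
/-- Alias of `ContactMeasure` keyed by the registered stub name. -/
abbrev stub_contactMeasure : Prop := ContactMeasure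
/-- Alias of `LayerCake` keyed by the registered stub name. -/
abbrev stub_layerCake : Prop := LayerCake

end Registered

/-! ### The composition: the three stubs imply the crux, BY NAME (no `sorry`) -/

/-- `StieltjesRepresentation` from the stubs: `Φ_N(t) := (ν_N((0,t])).toReal` with `ν` from STUB 2; monotone,
zero on `(-∞,0]`, bounded by `ν_N(ℝ)` (finiteness); for each `γ > 0`, uniqueness hypothesis and steady family,
STUB 1 gives the Green–Kubo limit, STUB 2 rewrites its value through the contact measure (using STUB 1's
integrability clause to pass the guard), STUB 3 turns it into the crux's distribution-function integral. -/
theorem StieltjesRepresentation_of (h1 : Registered.stub_greenKuboClosure)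
    (h2 : Registered.stub_contactMeasure) (h3 : Registered.stub_layerCake) :
    Summit.AtomisticToContinuum.FouriersLaw.Theses.ContactStieltjesMeasure.StieltjesRepresentation := by
  intro ω₂ lam β hω hl hβ T hT
  obtain ⟨ν, hfin, hnull, hid⟩ := h2 ω₂ lam β hω hl hβ T hT
  refine ⟨fun N t => (ν N (Set.Ioc 0 t)).toReal, fun N hN => ⟨?_, ?_, ?_, ?_⟩⟩
  · -- monotone: `(0,s] ⊆ (0,t]` for `s ≤ t`, finite measure
    intro s t hst
    haveI := hfin N
    exact ENNReal.toReal_mono (measure_ne_top _ _) (measure_mono (Set.Ioc_subset_Ioc_right hst))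
  · -- vanishing on `(-∞, 0]`: `(0,s] = ∅`
    intro s hs
    show (ν N (Set.Ioc 0 s)).toReal = 0
    rw [Set.Ioc_eq_empty (not_lt.mpr hs), measure_empty, ENNReal.toReal_zero]
  · -- bounded by the total mass
    refine ⟨(ν N Set.univ).toReal, fun s => ?_⟩
    haveI := hfin N
    exact ENNReal.toReal_mono (measure_ne_top _ _) (measure_mono (Set.subset_univ _))
  · -- the response at friction `γ`
    intro γ hγ hU μf hμf
    obtain ⟨hint, htend⟩ := h1 ω₂ lam β γ hω hl hβ hγ hU μf hμf T hT N hN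
    have hval := hid γ hγ N hN hint
    rw [hval, h3 (ν N) (hfin N) (hnull N) γ hγ] at htend
    exact htend

/-- Wiring check: the registered stubs feed `StieltjesRepresentation_of` as stated (this theorem depends on
`sorry` through the stubs only). -/
theorem stieltjesRepresentation_of_stubs :
    Summit.AtomisticToContinuum.FouriersLaw.Theses.ContactStieltjesMeasure.StieltjesRepresentation :=
  StieltjesRepresentation_of stub_greenKuboClosure stub_contactMeasure stub_layerCake

end Summit.AtomisticToContinuum.FouriersLaw.Cruxes.StieltjesRepresentation.Birth

end
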